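import Summits.Langlands.Langlands.Theses.IrreducibilityBySelfDuality
import Literature.NumberTheory.Automorphic.ClozelCArithmetic
import HarnessLib

/-!
# `IrreducibilityBySelfDuality.HeckeEigenvalueField` BY NAME: conditional closure from Clozel's
# theorem (item stmt-Langlands-13632, support, rank 1; `--supports`, conditional-result)

The route decl `Summit.Langlands.Langlands.Theses.IrreducibilityBySelfDuality.HeckeEigenvalueField`
is definitionally the tree's named fact
`Literature.NumberTheory.Automorphic.Clozel1990_heckeEigenvalueField` (Clozel 1990, Thm. 3.13 in
Hecke-eigenvalue form; second vendoring `Clozel1990_cArithmetic`). This small module states that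
AGAINST THE ROUTE DECL BY NAME, so that the obligation graph records the item as closed
CONDITIONALLY on the named fact (its discharge `_holds` is Clozel's cohomological argument, absent
from the tree). It imports the Theses file and is therefore NOT to be imported by any module that
closes an item of this route by name (kill criterion (e): the gate's `_holds` link would cycle);
the Theses-free companion `IrreducibilityBySelfDualityHeckeEigenvalueField.lean` carries the
reusable content (identifications, the algebraic half of Clozel's proof, the reduction to a
rational Hecke module).
-/

namespace Summit.Langlands.Langlands.Theorems.HeckeEigenvalueField

open Literature.NumberTheory.Automorphic

/-- The route decl `IrreducibilityBySelfDuality.HeckeEigenvalueField` is, definitionally, the named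
fact `Clozel1990_heckeEigenvalueField` (Clozel 1990, Thm. 3.13). [cite: Clozel1990, Thm. 3.13] -/
theorem route_heckeEigenvalueField_iff_clozel1990 :
    Summit.Langlands.Langlands.Theses.IrreducibilityBySelfDuality.HeckeEigenvalueField ↔
      Clozel1990_heckeEigenvalueField :=
  Iff.rfl

/-- The route decl `IrreducibilityBySelfDuality.HeckeEigenvalueField` is, definitionally, the
second vendoring `Clozel1990_cArithmetic` of Clozel 1990, Thm. 3.13. [cite: Clozel1990, Thm. 3.13] -/
theorem route_heckeEigenvalueField_iff_clozel1990_cArithmetic :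
    Summit.Langlands.Langlands.Theses.IrreducibilityBySelfDuality.HeckeEigenvalueField ↔
      Clozel1990_cArithmetic :=
  Iff.rfl

/-- **Conditional closure by name** (`conditional-result`): Clozel 1990, Thm. 3.13 (the named fact
`Clozel1990_heckeEigenvalueField`) gives the route decl
`IrreducibilityBySelfDuality.HeckeEigenvalueField`. The item closes unconditionally only with
`Clozel1990_heckeEigenvalueField_holds`. [cite: Clozel1990, Thm. 3.13] -/
theorem route_heckeEigenvalueField_of_clozel1990 (h : Clozel1990_heckeEigenvalueField) :
    Summit.Langlands.Langlands.Theses.IrreducibilityBySelfDuality.HeckeEigenvalueField :=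
  h

/-- The same from the second vendoring `Clozel1990_cArithmetic`. [cite: Clozel1990, Thm. 3.13] -/
theorem route_heckeEigenvalueField_of_clozel1990_cArithmetic (h : Clozel1990_cArithmetic) :
    Summit.Langlands.Langlands.Theses.IrreducibilityBySelfDuality.HeckeEigenvalueField :=
  h

end Summit.Langlands.Langlands.Theorems.HeckeEigenvalueField
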